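import Literature.NumberTheory.EllipticCurves.Sprung2012.ColemanPairExistsProofs
import Literature.NumberTheory.EllipticCurves.Sprung2024.ChromaticSmallControlSurjProofs
import HarnessLib

/-!
# The `Γ`-twist of Sprung's Coleman pairs, the vanishing of `Col(z)(0)` for functionals killing
# `E(K_v)`, and `Ann(E(K_v)) ⊆ Ker Col^• + (γ − 1)·H¹_Iw` from the surjectivity of `Col^•`
# (Sprung 2012 §7.1 "The image of the Coleman map", in the tree's transcription)

`Proofs` file (theorems only: **no definition, no named fact**), topic
`Literature/NumberTheory/EllipticCurves`, cluster `Sprung2012`; sequel of `ColemanMaps.lean`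
(the pairings `P_{n,x}`, `IsHondaSystem`, the Coleman characterisation `IsColemanPair`, the kernels
`colemanKer`), `ColemanPairExistsProofs.lean` (`exists_isColemanPair`, Props. 3.9/5.3) and — for the
constant-coefficient bookkeeping `constantCoeff_pairingSum`, `constantCoeff_toIwasawa_cyclotomicOmega` —
`Sprung2024/ChromaticSmallControlSurjProofs.lean` (whose §1 is the converse of §2 below). Source:
F. E. I. Sprung, *Iwasawa theory for elliptic curves at supersingular primes: A pair of main
conjectures*, J. Number Theory **132** (2012) 1483–1506 [Sprung2012], §7.1 (p. 1500: Def. 7.1/7.2,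
Prop. 7.3 "`Col♭` is surjective", p. 1501: Prop. 7.6 "If `η` is trivial, then `ε_η Col♯` is
surjective"), Def. 3.1 (p. 1489), Thm. 2.2 (p. 1487); and the USE made of §7.1 in F. Sprung, Adv.
Math. **449** (2024) 109741 [Sprung2024], §5.2, proof of Lemma 5.5, case `v = p` (p. 40: "By
construction, the right vertical map [`(H¹_Iw/ker Col⋆_p)_X → H¹(k_0, T)/ker Col⋆_{p,0}`] is an
isomorphism … The snake lemma thus shows that the left vertical map [`(ker Col⋆_p)_X → ker Col⋆_{p,0}`]
is surjective").

Under the transcription convention of `ColemanMaps.lean` (`H¹_Iw(T) ≅ Hom_ℤ(E(K_∞·K_v), ℤ_p)`,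
`P_{n,x}(z) = ∑_{j<pⁿ} z(gʲx)(1+T)ʲ`, `Col(z) = (L♯, L♭)` iff `IsColemanPair … z L♯ L♭`) this file
proves, for a local lift `g` of a topological generator and points `c_n` of level `n`:

* §1 **the `Γ`-twist** (`pairingSum_twist`, `IsColemanPair.twist`): for the functional
  `z' = z ∘ g⁻¹` (`x ↦ z(g⁻¹x)`), `P_{n,c_n}(z') = (1+T)·P_{n,c_n}(z) − z(g⁻¹c_n)·ω_n`, hence
  `Col(z ∘ g⁻¹) = (1+T)·Col(z)` and `Col(z ∘ g⁻¹ − z) = T·Col(z)` — the `Λ`-linearity of the Coleman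
  map for `γ ↦ 1 + T` (Sprung 2012 §2 p. 1486, "identify `Λ = ℤ_p[[G_∞]]` with `ℤ_p[Δ][[X]]` by sending
  `γ` to `1 + X`"), together with the additivity `IsColemanPair.add/.neg/.sub`;
* §2 **`Col(z)(0) = 0` when `z` kills `E(K_v)`** (`constantCoeff_eq_zero_of_apply_layer_zero`): the
  levels `n = 0, 1` of the characterisation read `L♭(0) = −z(c_0)` and `L♯(0) = −z(Tr_{1/0} c_1)`
  (Def. 7.2: "`Col_0 = (−a_p P¹_0 + P⁰_0, −P¹_0)`", "`Col♭_1 = −P¹_1`"), and `c_0`,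
  `Tr_{1/0} c_1 = a_p c_0 − (p−1)c_{−1}` lie in `E(K_v)` (Thm. 2.2) — the converse direction of
  `colemanKer_apply_eq_zero_of_mem_localLayerPointsOfEmb_zero` (`Sprung2024/ChromaticSmallControlSurjProofs`);
* §3 **`Ann(E(K_v)) ⊆ Ker Col^• + (γ−1)H¹_Iw`** (`exists_mem_colemanKer_add_twist_of_apply_layer_zero`):
  if `Col^•` is SURJECTIVE onto `Λ` (hypothesis `hsurj`; = Prop. 7.3 for `• = ♭`, Prop. 7.6 (`η = 1`)
  for `• = ♯` — named facts of the sibling statement file, NOT asserted here), then every functional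
  `z` vanishing on `E(K_v)` is `z₁ + (w ∘ g⁻¹ − w)` with `z₁ ∈ Ker Col^•`: by §2 `Col^•(z) = T·f`, by
  `hsurj` `f = Col^•(w)`, by §1 `Col^•(w ∘ g⁻¹ − w) = T·f`, so `z₁ := z − (w ∘ g⁻¹ − w) ∈ Ker Col^•`.
  This is the Pontryagin dual of the surjection `(ker Col⋆_p)_X ↠ ker Col⋆_{p,0}` of [Sprung2024]
  p. 40, i.e. of the injectivity of `r_p` (Lemma 5.5, case `v = p`), consumed by
  `Sprung2024/ChromaticLocalInjectivityProofs.lean`.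

HONEST FRAMING (cell `bsd-ssimc`, seat `bsd-ssimc-k3c5-kdot-split` g6, object «KDOT-L55-KERNEL»,
route K3 `SignedLowerHalves`, crux `SprungLowerHalfAtThree` = stmt-BirchSwinnertonDyer-19003 and
its split child K2 = stmt-BirchSwinnertonDyer-19877): pure algebra inside the tree's transcription;
nothing about any curve is asserted; no census cell moves; BSD is not proved by any of this.

## References
* [Sprung2012] §2 p. 1486 (`γ ↦ 1 + X`), Thm. 2.2 (p. 1487), Def. 3.1 (p. 1489), Def. 5.9
  (p. 1495), Def. 7.1–7.2 and Prop. 7.3 (p. 1500), Prop. 7.6 (p. 1501), Def. 7.9 (p. 1503).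
* [Sprung2024] §5.2, proof of Lemma 5.5, case `v = p` (p. 40); arXiv:1610.10017 §4 p. 15.
* [Kobayashi2003] S. Kobayashi, Invent. Math. 152 (2003), Prop. 8.23, proof of Prop. 9.2.

## Design
Theorems only; `noncomputable section`; `open scoped Classical`; one universe `u`; everything in
`namespace Literature.NumberTheory.EllipticCurves.Sprung2012`. The twisted functional `z ∘ g⁻¹` is
not introduced as a definition: statements take any `z'` with `z' x = z (g⁻¹ • x)` (`hz'`), and
§3 constructs it inside the proof.
-/

noncomputable section

open scoped Classical

open Polynomial

universe u

namespace Literature.NumberTheory.EllipticCurves.Sprung2012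

open Literature.NumberTheory.EllipticCurves Literature.NumberTheory.GaloisRepresentations ZpExtension
  Literature.NumberTheory.EllipticCurves.Kobayashi2003 Literature.NumberTheory.EllipticCurves.Sprung2017

variable {K : Type u} [Field K] {p : ℕ} [Fact p.Prime] (κ : ZpExtension K p)
variable {E : Type u} [Field E] [Algebra K E] (ι : AlgebraicClosure K →ₐ[K] AlgebraicClosure E)
variable (W : WeierstrassCurve K)

/-! ## §0 Small algebra: `ω_n ↦ (1+T)^{pⁿ} − 1`, additivity of Coleman pairs -/

/-- The image of `ω_n = (1 + T)^{pⁿ} − 1 ∈ ℤ[T]` in `Λ = ℤ_p⟦T⟧` is `(1 + T)^{pⁿ} − 1`.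
[cite: Pollack2003, Thm. 6.17 (ω_n = (1+T)^{p^n} − 1)] -/
theorem toIwasawa_cyclotomicOmega (n : ℕ) :
    toIwasawa p (cyclotomicOmega p n) = (1 + PowerSeries.X) ^ p ^ n - 1 := by
  rw [cyclotomicOmega, map_sub, map_pow, map_add, map_one,
    show toIwasawa p (X : ℤ[X]) = PowerSeries.X by
      rw [show toIwasawa p (X : ℤ[X]) = (((X : ℤ[X]).map (Int.castRingHom ℤ_[p]) : ℤ_[p][X]) :
        PowerSeries ℤ_[p]) from rfl, Polynomial.map_X, Polynomial.coe_X], add_comm]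

/-- `P_{n,x}` respects subtraction of functionals. [cite: Sprung2012, Def. 3.1 (p. 1489) ("By linearity")] -/
theorem pairingSum_sub (A : AddSubgroup (localPoints W E)) (g : Field.absoluteGaloisGroup E) (n : ℕ)
    (x : localPoints W E) (z z' : A →+ ℤ_[p]) :
    pairingSum W A g n x (z - z') = pairingSum W A g n x z - pairingSum W A g n x z' := by
  rw [eq_sub_iff_add_eq, ← pairingSum_add, sub_add_cancel]

variable {κ ι W}

/-- Coleman pairs add: `Col(z + z') = Col(z) + Col(z')`.
[cite: Sprung2012, Def. 5.9 (p. 1495) (Col is a homomorphism)] -/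
theorem IsColemanPair.add {ap : ℤ} {g : Field.absoluteGaloisGroup E} {c : ℕ → localPoints W E}
    {z z' : localTowerPointsOfEmb κ ι W →+ ℤ_[p]} {Ls Lf Ls' Lf' : IwasawaAlgebra p}
    (h : IsColemanPair κ ι W ap g c z Ls Lf) (h' : IsColemanPair κ ι W ap g c z' Ls' Lf') :
    IsColemanPair κ ι W ap g c (z + z') (Ls + Ls') (Lf + Lf') := by
  intro n
  have key : pairingSum W (localTowerPointsOfEmb κ ι W) g n (c n) (z + z') +
      (toIwasawa p (sharpPoly ap p n) * (Ls + Ls') + toIwasawa p (flatPoly ap p n) * (Lf + Lf')) =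
      (pairingSum W (localTowerPointsOfEmb κ ι W) g n (c n) z +
        (toIwasawa p (sharpPoly ap p n) * Ls + toIwasawa p (flatPoly ap p n) * Lf)) +
      (pairingSum W (localTowerPointsOfEmb κ ι W) g n (c n) z' +
        (toIwasawa p (sharpPoly ap p n) * Ls' + toIwasawa p (flatPoly ap p n) * Lf')) := by
    rw [pairingSum_add]; ring
  rw [key]
  exact dvd_add (h n) (h' n)

/-- Coleman pairs subtract: `Col(z − z') = Col(z) − Col(z')`.
[cite: Sprung2012, Def. 5.9 (p. 1495) (Col is a homomorphism)] -/
theorem IsColemanPair.sub {ap : ℤ} {g : Field.absoluteGaloisGroup E} {c : ℕ → localPoints W E}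
    {z z' : localTowerPointsOfEmb κ ι W →+ ℤ_[p]} {Ls Lf Ls' Lf' : IwasawaAlgebra p}
    (h : IsColemanPair κ ι W ap g c z Ls Lf) (h' : IsColemanPair κ ι W ap g c z' Ls' Lf') :
    IsColemanPair κ ι W ap g c (z - z') (Ls - Ls') (Lf - Lf') := by
  intro n
  have key : pairingSum W (localTowerPointsOfEmb κ ι W) g n (c n) (z - z') +
      (toIwasawa p (sharpPoly ap p n) * (Ls - Ls') + toIwasawa p (flatPoly ap p n) * (Lf - Lf')) =
      (pairingSum W (localTowerPointsOfEmb κ ι W) g n (c n) z +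
        (toIwasawa p (sharpPoly ap p n) * Ls + toIwasawa p (flatPoly ap p n) * Lf)) -
      (pairingSum W (localTowerPointsOfEmb κ ι W) g n (c n) z' +
        (toIwasawa p (sharpPoly ap p n) * Ls' + toIwasawa p (flatPoly ap p n) * Lf')) := by
    rw [pairingSum_sub]; ring
  rw [key]
  exact dvd_sub (h n) (h' n)

/-! ## §1 The `Γ`-twist `z ↦ z ∘ g⁻¹` multiplies the Coleman value by `1 + T` -/

variable (κ ι W)

/-- If `g^{m+1}` fixes `x` then `gᵐ·x = g⁻¹·x`. [folklore] -/
private theorem pow_smul_eq_inv_smul_of_pow_succ_smul {g : Field.absoluteGaloisGroup E} {x : localPoints W E}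
    {m : ℕ} (h : g ^ (m + 1) • x = x) : g ^ m • x = g⁻¹ • x := by
  calc g ^ m • x = (g⁻¹ * g ^ (m + 1)) • x := by rw [pow_succ', inv_mul_cancel_left]
    _ = g⁻¹ • x := by rw [mul_smul, h]

/-- For a point `x` of level `n` and a local lift `g` of the generator, `g^{m}·x = g⁻¹·x` whenever
`pⁿ = m + 1` (`g^{pⁿ}` fixes `x`). [cite: Sprung2012, §2 p. 1486 (Γ_n = Gal(k_∞/k_n))] -/
theorem pow_smul_eq_inv_smul_of_mem_layer {g : Field.absoluteGaloisGroup E}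
    (hg : κ.IsTopGenerator (resGalOfEmb ι g)) {n : ℕ} {x : localPoints W E}
    (hx : x ∈ localLayerPointsOfEmb κ ι W n) {m : ℕ} (hm : p ^ n = m + 1) : g ^ m • x = g⁻¹ • x := by
  apply pow_smul_eq_inv_smul_of_pow_succ_smul W
  have h := pow_mul_smul_of_mem_localLayerPointsOfEmb κ ι W hg hx 1
  rwa [mul_one, hm] at h

/-- **The `Γ`-twist of the pairing.** For `x` of level `n`, a functional `z` on `E(K_∞·K_v)` and
the twisted functional `z' = z ∘ g⁻¹` (`z'(y) = z(g⁻¹y)`):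
`P_{n,x}(z') = (1+T)·P_{n,x}(z) − z(g⁻¹x)·ω_n` in `Λ` — so `P_{n,x}(z ∘ g⁻¹) ≡ (1+T) P_{n,x}(z)
(mod ω_n)`, the `ℤ_p[G_n]`-linearity of Def. 3.1 for `γ ↦ 1+T`.
[cite: Sprung2012, Def. 3.1 (p. 1489) and §2 p. 1486 (γ ↦ 1 + X)] -/
theorem pairingSum_twist {g : Field.absoluteGaloisGroup E} (hg : κ.IsTopGenerator (resGalOfEmb ι g))
    {n : ℕ} {x : localPoints W E} (hx : x ∈ localLayerPointsOfEmb κ ι W n)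
    (z z' : localTowerPointsOfEmb κ ι W →+ ℤ_[p])
    (hz' : ∀ y : localTowerPointsOfEmb κ ι W,
      z' y = z ⟨g⁻¹ • (y : localPoints W E), smul_mem_localTowerPointsOfEmb κ ι W g⁻¹ y.2⟩) :
    pairingSum W (localTowerPointsOfEmb κ ι W) g n x z' =
      (1 + PowerSeries.X) * pairingSum W (localTowerPointsOfEmb κ ι W) g n x z -
        PowerSeries.C (z ⟨g⁻¹ • x, smul_mem_localTowerPointsOfEmb κ ι W g⁻¹
          (localLayerPointsOfEmb_le_localTowerPointsOfEmb κ ι W n hx)⟩) *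
          toIwasawa p (cyclotomicOmega p n) := by
  have hxT : x ∈ localTowerPointsOfEmb κ ι W := localLayerPointsOfEmb_le_localTowerPointsOfEmb κ ι W n hx
  have hmem : ∀ j : ℕ, g ^ j • x ∈ localTowerPointsOfEmb κ ι W := fun j ↦
    smul_mem_localTowerPointsOfEmb κ ι W _ hxT
  have hmem' : ∀ (h : Field.absoluteGaloisGroup E), h • x ∈ localTowerPointsOfEmb κ ι W := fun h ↦
    smul_mem_localTowerPointsOfEmb κ ι W _ hxT
  -- the values `a j = z(gʲ x)` and `u = z(g⁻¹ x)`
  set a : ℕ → ℤ_[p] := fun j ↦ z ⟨g ^ j • x, hmem j⟩ with ha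
  set u : ℤ_[p] := z ⟨g⁻¹ • x, hmem' g⁻¹⟩ with hu
  -- `evalOn z (gʲ x) = a j`, `evalOn z' (gʲ x) = z(g⁻¹ gʲ x)`
  have hev : ∀ j : ℕ, evalOn W (localTowerPointsOfEmb κ ι W) z (g ^ j • x) = a j := fun j ↦
    evalOn_of_mem W _ z (hmem j)
  have hev'0 : evalOn W (localTowerPointsOfEmb κ ι W) z' (g ^ 0 • x) = u := by
    rw [evalOn_of_mem W _ z' (hmem 0), hz']
    simp only [pow_zero, one_smul, hu]
  have hev'succ : ∀ j : ℕ, evalOn W (localTowerPointsOfEmb κ ι W) z' (g ^ (j + 1) • x) = a j := by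
    intro j
    rw [evalOn_of_mem W _ z' (hmem (j + 1)), hz', ha]
    congr 1
    apply Subtype.ext
    change g⁻¹ • (g ^ (j + 1) • x) = g ^ j • x
    rw [← mul_smul, pow_succ', inv_mul_cancel_left]
  -- `pⁿ = m + 1` and `a m = u`
  obtain ⟨m, hm⟩ : ∃ m, p ^ n = m + 1 :=
    ⟨p ^ n - 1, (Nat.sub_add_cancel (Nat.one_le_pow _ _ (Fact.out : p.Prime).pos)).symm⟩
  have hlast : a m = u := by
    simp only [ha, hu]
    congr 1
    exact Subtype.ext (pow_smul_eq_inv_smul_of_mem_layer κ ι W hg hx hm)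
  -- compute both sides
  rw [pairingSum_def, pairingSum_def, toIwasawa_cyclotomicOmega, hm, Finset.sum_range_succ',
    Finset.sum_range_succ, hev'0]
  simp only [hev'succ, hev]
  rw [hlast, mul_add, Finset.mul_sum]
  have hrw : ∀ j ∈ Finset.range m,
      (1 + PowerSeries.X) * (PowerSeries.C (a j) * (1 + PowerSeries.X) ^ j) =
        PowerSeries.C (a j) * (1 + PowerSeries.X) ^ (j + 1) := by
    intro j _; ring
  rw [Finset.sum_congr rfl hrw]
  ring

/-- **`Col(z ∘ g⁻¹) = (1+T)·Col(z)`**: if `(L♯, L♭)` is a Coleman pair for `z` (points `c_n` of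
level `n`), then `((1+T)L♯, (1+T)L♭)` is one for the twisted functional `z' = z ∘ g⁻¹` — the
`Λ`-linearity of the Coleman map (`γ ↦ 1 + T`).
[cite: Sprung2012, Def. 5.9 (p. 1495) and §2 p. 1486 (Col is Λ-linear, γ ↦ 1 + X)] -/
theorem IsColemanPair.twist {ap : ℤ} {g : Field.absoluteGaloisGroup E}
    (hg : κ.IsTopGenerator (resGalOfEmb ι g)) {c : ℕ → localPoints W E}
    (hc : ∀ n, c n ∈ localLayerPointsOfEmb κ ι W n)
    {z z' : localTowerPointsOfEmb κ ι W →+ ℤ_[p]}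
    (hz' : ∀ y : localTowerPointsOfEmb κ ι W,
      z' y = z ⟨g⁻¹ • (y : localPoints W E), smul_mem_localTowerPointsOfEmb κ ι W g⁻¹ y.2⟩)
    {Ls Lf : IwasawaAlgebra p} (h : IsColemanPair κ ι W ap g c z Ls Lf) :
    IsColemanPair κ ι W ap g c z' ((1 + PowerSeries.X) * Ls) ((1 + PowerSeries.X) * Lf) := by
  intro n
  rw [pairingSum_twist κ ι W hg (hc n) z z' hz']
  have key : (1 + PowerSeries.X) * pairingSum W (localTowerPointsOfEmb κ ι W) g n (c n) z -
      PowerSeries.C (z ⟨g⁻¹ • c n, smul_mem_localTowerPointsOfEmb κ ι W g⁻¹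
        (localLayerPointsOfEmb_le_localTowerPointsOfEmb κ ι W n (hc n))⟩) *
        toIwasawa p (cyclotomicOmega p n) +
      (toIwasawa p (sharpPoly ap p n) * ((1 + PowerSeries.X) * Ls) +
        toIwasawa p (flatPoly ap p n) * ((1 + PowerSeries.X) * Lf)) =
      (1 + PowerSeries.X) * (pairingSum W (localTowerPointsOfEmb κ ι W) g n (c n) z +
        (toIwasawa p (sharpPoly ap p n) * Ls + toIwasawa p (flatPoly ap p n) * Lf)) -
      PowerSeries.C (z ⟨g⁻¹ • c n, smul_mem_localTowerPointsOfEmb κ ι W g⁻¹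
        (localLayerPointsOfEmb_le_localTowerPointsOfEmb κ ι W n (hc n))⟩) *
        toIwasawa p (cyclotomicOmega p n) := by ring
  rw [key]
  exact dvd_sub (dvd_mul_of_dvd_right (h n) _) (dvd_mul_left _ _)

/-- **`Col(z ∘ g⁻¹ − z) = T·Col(z)`**: the functional `z ∘ g⁻¹ − z` ("`(γ − 1)·z`") has Coleman
pair `(T·L♯, T·L♭)`. [cite: Sprung2012, Def. 5.9 (p. 1495) and §2 p. 1486 (T = γ − 1)] -/
theorem IsColemanPair.twist_sub {ap : ℤ} {g : Field.absoluteGaloisGroup E}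
    (hg : κ.IsTopGenerator (resGalOfEmb ι g)) {c : ℕ → localPoints W E}
    (hc : ∀ n, c n ∈ localLayerPointsOfEmb κ ι W n)
    {z z' : localTowerPointsOfEmb κ ι W →+ ℤ_[p]}
    (hz' : ∀ y : localTowerPointsOfEmb κ ι W,
      z' y = z ⟨g⁻¹ • (y : localPoints W E), smul_mem_localTowerPointsOfEmb κ ι W g⁻¹ y.2⟩)
    {Ls Lf : IwasawaAlgebra p} (h : IsColemanPair κ ι W ap g c z Ls Lf) :
    IsColemanPair κ ι W ap g c (z' - z) (PowerSeries.X * Ls) (PowerSeries.X * Lf) := by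
  have h2 := (h.twist κ ι W hg hc hz').sub h
  have e1 : (1 + PowerSeries.X) * Ls - Ls = PowerSeries.X * Ls := by ring
  have e2 : (1 + PowerSeries.X) * Lf - Lf = PowerSeries.X * Lf := by ring
  rwa [e1, e2] at h2

/-- The twisted functional `z ∘ g⁻¹` exists (as an additive map on `E(K_∞·K_v)`, which is
`Γ_{K_v}`-stable). [cite: Sprung2012, Def. 3.1 (p. 1489) (the G_n-action on functionals)] -/
theorem exists_twist (g : Field.absoluteGaloisGroup E) (z : localTowerPointsOfEmb κ ι W →+ ℤ_[p]) :
    ∃ z' : localTowerPointsOfEmb κ ι W →+ ℤ_[p], ∀ y : localTowerPointsOfEmb κ ι W,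
      z' y = z ⟨g⁻¹ • (y : localPoints W E), smul_mem_localTowerPointsOfEmb κ ι W g⁻¹ y.2⟩ := by
  let φ : localTowerPointsOfEmb κ ι W →+ localTowerPointsOfEmb κ ι W :=
    { toFun := fun y ↦ ⟨g⁻¹ • (y : localPoints W E), smul_mem_localTowerPointsOfEmb κ ι W g⁻¹ y.2⟩
      map_zero' := Subtype.ext (by simp)
      map_add' := fun a b ↦ Subtype.ext (by simp [smul_add]) }
  exact ⟨z.comp φ, fun y ↦ rfl⟩

/-! ## §2 `Col(z)(0) = 0` for functionals killing the bottom layer `E(K_v)` -/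

/-- A multiple of `ω_n` in `Λ` has vanishing constant coefficient (`ω_n(0) = 0`).
[cite: Pollack2003, Thm. 6.17 (ω_n = (1+T)^{p^n} − 1)] -/
theorem constantCoeff_eq_zero_of_toIwasawa_cyclotomicOmega_dvd {n : ℕ} {A : IwasawaAlgebra p}
    (h : toIwasawa p (cyclotomicOmega p n) ∣ A) : PowerSeries.constantCoeff A = 0 := by
  obtain ⟨q, rfl⟩ := h
  rw [map_mul, constantCoeff_toIwasawa_cyclotomicOmega, zero_mul]

/-- **`L♭(z)(0) = 0` and `L♯(z)(0) = 0` for a functional `z` vanishing on `E(K_v) = E(K_0·K_v)`.**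
Levels `0` and `1` of the Coleman characterisation (Def. 7.2: `Col♭_0 = −P¹_0`, `Col♭_1 = −P¹_1`,
i.e. `L♭ ≡ −z(c_0) (mod T)`, `L♯ ≡ −P_{1,c_1}(z) (mod ω_1)`) give `L♭(0) = −z(c_0)` and
`L♯(0) = −∑_{k<p} z(gᵏc_1) = −z(Tr_{1/0} c_1)`; and `c_0 ∈ E(K_v)`,
`Tr_{1/0} c_1 = a_p c_0 − (p−1) c_{−1} ∈ E(K_v)` by the Honda relations (Thm. 2.2), so both vanish.
(The converse computation of `colemanKer_apply_eq_zero_of_mem_localLayerPointsOfEmb_zero`.)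
[cite: Sprung2012, Def. 7.2 (p. 1500) and Thm. 2.2 (p. 1487)] -/
theorem constantCoeff_eq_zero_of_apply_layer_zero {ap : ℤ} {g : Field.absoluteGaloisGroup E}
    (hg : κ.IsTopGenerator (resGalOfEmb ι g)) {cneg : localPoints W E} {c : ℕ → localPoints W E}
    (hH : IsHondaSystem κ ι W ap g cneg c) {z : localTowerPointsOfEmb κ ι W →+ ℤ_[p]}
    (hz0 : ∀ (x : localPoints W E) (hx : x ∈ localLayerPointsOfEmb κ ι W 0),
      z ⟨x, localLayerPointsOfEmb_le_localTowerPointsOfEmb κ ι W 0 hx⟩ = 0)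
    {Ls Lf : IwasawaAlgebra p} (hCP : IsColemanPair κ ι W ap g c z Ls Lf) :
    PowerSeries.constantCoeff Ls = 0 ∧ PowerSeries.constantCoeff Lf = 0 := by
  obtain ⟨hcneg, hc, _, hTr1, -, -, -, -, -⟩ := hH
  have hle := fun n ↦ localLayerPointsOfEmb_le_localTowerPointsOfEmb κ ι W n
  -- `z(c_0) = 0`
  have hzc0 : z ⟨c 0, hle 0 (hc 0)⟩ = 0 := hz0 _ (hc 0)
  -- `Tr_{1/0} c_1 ∈ E(K_v)` and `z` of it vanishes
  have hTrmem0 : localTraceOfEmb κ ι W 0 1 (c 1) ∈ localLayerPointsOfEmb κ ι W 0 := by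
    rw [hTr1]
    exact sub_mem (AddSubgroup.zsmul_mem _ (hc 0) _) (AddSubgroup.zsmul_mem _ hcneg _)
  have hTrmem : localTraceOfEmb κ ι W 0 1 (c 1) ∈ localTowerPointsOfEmb κ ι W := hle 0 hTrmem0
  have hzTr : z ⟨localTraceOfEmb κ ι W 0 1 (c 1), hTrmem⟩ = 0 := hz0 _ hTrmem0
  have hsum : ∑ j ∈ Finset.range p, evalOn W (localTowerPointsOfEmb κ ι W) z (g ^ j • c 1) =
      z ⟨localTraceOfEmb κ ι W 0 1 (c 1), hTrmem⟩ := by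
    have hmem : ∀ j : ℕ, g ^ j • c 1 ∈ localTowerPointsOfEmb κ ι W := fun j ↦
      smul_mem_localTowerPointsOfEmb κ ι W _ (hle 1 (hc 1))
    have h : (⟨localTraceOfEmb κ ι W 0 1 (c 1), hTrmem⟩ : localTowerPointsOfEmb κ ι W) =
        ∑ j ∈ Finset.range p, ⟨g ^ j • c 1, hmem j⟩ := by
      apply Subtype.ext
      change localTraceOfEmb κ ι W 0 1 (c 1) =
        ((∑ j ∈ Finset.range p, (⟨g ^ j • c 1, hmem j⟩ : localTowerPointsOfEmb κ ι W) :
          localTowerPointsOfEmb κ ι W) : localPoints W E)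
      rw [AddSubmonoidClass.coe_finsetSum, localTraceOfEmb_succ_eq_sum_pow_smul κ ι W hg 0 (hc 1)]
      refine Finset.sum_congr rfl fun j _ => ?_
      rw [pow_zero, one_mul]
    rw [h, map_sum]
    exact Finset.sum_congr rfl fun j _ => evalOn_of_mem W _ z (hmem j)
  -- level 0: `z(c_0) + L♭(0) = 0`
  have hlev0 : PowerSeries.constantCoeff Lf = 0 := by
    have h := hCP 0
    rw [sharpPoly_zero, flatPoly_zero, map_zero, map_one, zero_mul, one_mul, zero_add] at h
    have h' := constantCoeff_eq_zero_of_toIwasawa_cyclotomicOmega_dvd h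
    rw [map_add, constantCoeff_pairingSum] at h'
    simp only [pow_zero, Finset.sum_range_one, one_smul] at h'
    rwa [evalOn_of_mem W _ z (hle 0 (hc 0)), hzc0, zero_add] at h'
  -- level 1: `z(Tr_{1/0} c_1) + L♯(0) = 0`
  have hlev1 : PowerSeries.constantCoeff Ls = 0 := by
    have h := hCP 1
    rw [sharpPoly_one, flatPoly_one, map_one, map_zero, one_mul, zero_mul, add_zero] at h
    have h' := constantCoeff_eq_zero_of_toIwasawa_cyclotomicOmega_dvd h
    rw [map_add, constantCoeff_pairingSum, pow_one, hsum, hzTr, zero_add] at h'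
    exact h'
  exact ⟨hlev1, hlev0⟩

/-- Hence `T ∣ L^•(z)` for both colours when `z` kills `E(K_v)`.
[cite: Sprung2012, Def. 7.2 (p. 1500) and Thm. 2.2 (p. 1487)] -/
theorem X_dvd_chromaticL_of_apply_layer_zero {ap : ℤ} {g : Field.absoluteGaloisGroup E}
    (hg : κ.IsTopGenerator (resGalOfEmb ι g)) {cneg : localPoints W E} {c : ℕ → localPoints W E}
    (hH : IsHondaSystem κ ι W ap g cneg c) {z : localTowerPointsOfEmb κ ι W →+ ℤ_[p]}
    (hz0 : ∀ (x : localPoints W E) (hx : x ∈ localLayerPointsOfEmb κ ι W 0),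
      z ⟨x, localLayerPointsOfEmb_le_localTowerPointsOfEmb κ ι W 0 hx⟩ = 0)
    {Ls Lf : IwasawaAlgebra p} (hCP : IsColemanPair κ ι W ap g c z Ls Lf) (col : Chroma) :
    (PowerSeries.X : IwasawaAlgebra p) ∣ chromaticL col Ls Lf := by
  obtain ⟨hs, hf⟩ := constantCoeff_eq_zero_of_apply_layer_zero κ ι W hg hH hz0 hCP
  cases col with
  | sharp => rw [chromaticL_sharp]; exact PowerSeries.X_dvd_iff.mpr hs
  | flat => rw [chromaticL_flat]; exact PowerSeries.X_dvd_iff.mpr hf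

/-! ## §3 `Ann(E(K_v)) ⊆ Ker Col^• + (γ − 1)·H¹_Iw` from the surjectivity of `Col^•` -/

/-- **A functional vanishing on `E(K_v)` is `z₁ + (w ∘ g⁻¹ − w)` with `z₁ ∈ Ker Col^•`, provided
`Col^•` is surjective** — the Pontryagin dual of "`(ker Col⋆_p)_X → ker Col⋆_{p,0}` is surjective"
([Sprung2024] p. 40, proof of Lemma 5.5, case `v = p`; [Kobayashi2003] proof of Prop. 9.2). Inputs:
`p ∣ a_p`, a local lift `g` of the generator, a Honda system (Thm. 2.2: levels and trace
relations), the colour `•`, and the SURJECTIVITY hypothesis `hsurj` "every `f ∈ Λ` is the `•`-Coleman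
value of some functional" (= Sprung 2012 Prop. 7.3 for `♭`, Prop. 7.6 (`η = 1`) for `♯`; NOT asserted
here). Proof: `Col(z)` exists (`exists_isColemanPair`); by §2 `L^•(z) = T·f`; `f = L^•(w)` by
`hsurj`; by §1 `w ∘ g⁻¹ − w` has Coleman pair `T·Col(w)`; so `z − (w ∘ g⁻¹ − w)` has a Coleman pair
with vanishing `•`-component, i.e. lies in `colemanKer … •`.
[cite: Sprung2012, Prop. 7.3 (p. 1500) and Prop. 7.6 (p. 1501)]
[cite: Sprung2024, §5.2 proof of Lemma 5.5, case v = p (p. 40)] -/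
theorem exists_mem_colemanKer_add_twist_of_apply_layer_zero {ap : ℤ} (hap : (p : ℤ) ∣ ap)
    {g : Field.absoluteGaloisGroup E} (hg : κ.IsTopGenerator (resGalOfEmb ι g))
    {cneg : localPoints W E} {c : ℕ → localPoints W E} (hH : IsHondaSystem κ ι W ap g cneg c)
    (col : Chroma)
    (hsurj : ∀ f : IwasawaAlgebra p, ∃ (w : localTowerPointsOfEmb κ ι W →+ ℤ_[p])
      (Ls Lf : IwasawaAlgebra p), IsColemanPair κ ι W ap g c w Ls Lf ∧ chromaticL col Ls Lf = f)
    {z : localTowerPointsOfEmb κ ι W →+ ℤ_[p]}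
    (hz0 : ∀ (x : localPoints W E) (hx : x ∈ localLayerPointsOfEmb κ ι W 0),
      z ⟨x, localLayerPointsOfEmb_le_localTowerPointsOfEmb κ ι W 0 hx⟩ = 0) :
    ∃ (z₁ w : localTowerPointsOfEmb κ ι W →+ ℤ_[p]), z₁ ∈ colemanKer κ ι W ap g c col ∧
      ∀ y : localTowerPointsOfEmb κ ι W, z y = z₁ y +
        (w ⟨g⁻¹ • (y : localPoints W E), smul_mem_localTowerPointsOfEmb κ ι W g⁻¹ y.2⟩ - w y) := by
  have hc : ∀ n, c n ∈ localLayerPointsOfEmb κ ι W n := hH.2.1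
  obtain ⟨Ls, Lf, hCP⟩ := exists_isColemanPair κ ι W hg hap hH z
  obtain ⟨f, hf⟩ := X_dvd_chromaticL_of_apply_layer_zero κ ι W hg hH hz0 hCP col
  obtain ⟨w, Ls', Lf', hw, hcol⟩ := hsurj f
  obtain ⟨w', hw'⟩ := exists_twist κ ι W g w
  have hδ : IsColemanPair κ ι W ap g c (w' - w) (PowerSeries.X * Ls') (PowerSeries.X * Lf') :=
    hw.twist_sub κ ι W hg hc hw'
  have hz₁ : IsColemanPair κ ι W ap g c (z - (w' - w)) (Ls - PowerSeries.X * Ls')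
      (Lf - PowerSeries.X * Lf') := hCP.sub hδ
  refine ⟨z - (w' - w), w, ⟨_, _, hz₁, ?_⟩, fun y ↦ ?_⟩
  · cases col with
    | sharp =>
      rw [chromaticL_sharp] at hf hcol ⊢
      rw [hf, hcol, sub_self]
    | flat =>
      rw [chromaticL_flat] at hf hcol ⊢
      rw [hf, hcol, sub_self]
  · rw [AddMonoidHom.sub_apply, AddMonoidHom.sub_apply, hw' y, sub_add_cancel]

end Literature.NumberTheory.EllipticCurves.Sprung2012

end
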